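import Summits.CriticalPhenomena.PercolationContinuityZ3.Theorems.PercNearOneGluingNoHeavyLowerTailSahiGridPatternRoundingShadow

/-!
# `NoHeavyLowerTail` (crux stmt-CriticalPhenomena-4575), Sahi programme P1: the rounding calculus, part 5 —
# **THE REDUCTION IS LOSSLESS**: `PatternPos d ⟺ ResolvedPos d ∧ RoundingAlternativeNeg d`

Support file (seat `prim-sahi-p1`, generation 12; `--supports stmt-CriticalPhenomena-4575`).  Pure proofs; one finite `Prop`
(`RoundingAlternativeNeg d`, an obligation / hypothesis, never a fact); no `sorry`, standard axioms.  Vocabulary of `…SahiGridPatternRounding{,Shadow}`.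

THE MATHEMATICS.  The rounding alternative is only ever needed at triples where the pattern functional is NEGATIVE: if `sStarD A B C < 0` and some rounding
on an unresolved axis does not increase `sStarD`, the rounded triple is again negative with fewer unresolved axes; descending, one reaches a negative triple
resolved on every axis, which `ResolvedPos d` forbids.  So with
`RoundingAlternativeNeg d :⟺` every up-set triple with `sStarD < 0` and an unresolved axis admits a non-increasing rounding on an unresolved axis,
we get **`patternPos_iff_resolvedPos_and_roundingAlternativeNeg : PatternPos d ↔ ResolvedPos d ∧ RoundingAlternativeNeg d`** (the converse is
trivial: under `PatternPos d` there are no negative triples).  Consequently (`patternPos_iff_twistedTPP_and_roundingAlternativeNeg`) the pattern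
inequality in dimension `d` is EQUIVALENT to: twisted three-partition positivity on `d` letters AND the negative-triple rounding alternative — a proof of
Kahn's Conjecture 5 in `d` coordinates may therefore assume it is looking at a NEGATIVE configuration (indeed at a negative minimiser, where the extremal
structure of the seat memo — e.g. every maximal non-element of one set lies in the other two — is available).  `RoundingAlternative d → RoundingAlternativeNeg d`
(`roundingAlternativeNeg_of_roundingAlternative`).  HONEST LABEL: nothing here asserts `PatternPos d` (`d ≥ 4`). [this work]
-/

namespace Summit.CriticalPhenomena.PercolationContinuityZ3.Theorems.SahiGridPattern

open Finset
open scoped Classical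
open Summit.CriticalPhenomena.PercolationContinuityZ3.Theorems.ThreePartition (threePartNT)

variable {d : ℕ}

/-- **`RoundingAlternativeNeg d`**: the rounding alternative demanded only of NEGATIVE triples — every up-set triple with `sStarD A B C < 0` and an
unresolved axis admits, on some unresolved axis, a simultaneous rounding that does not increase `sStarD`.  Implied by `PatternPos d` (vacuously) and by
`RoundingAlternative d`; an obligation / hypothesis, never a fact. [this work] [status: open for d ≥ 4] -/
@[conjecture] def RoundingAlternativeNeg (d : ℕ) : Prop :=
  ∀ A B C : Finset (Pd d), IsUpperSet (A : Set (Pd d)) → IsUpperSet (B : Set (Pd d)) → IsUpperSet (C : Set (Pd d)) →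
    sStarD A B C < 0 → (∃ a, ¬ Resolved a A B C) →
      ∃ (a : Fin d) (j : Fin 2) (sA sB sC : Bool), ¬ Resolved a A B C ∧
        sStarD (rnd sA a j A) (rnd sB a j B) (rnd sC a j C) ≤ sStarD A B C

/-- The full alternative implies the negative-triple one. [this work] -/
theorem roundingAlternativeNeg_of_roundingAlternative (h : RoundingAlternative d) : RoundingAlternativeNeg d :=
  fun A B C hA hB hC _ hex => h A B C hA hB hC hex

/-- `PatternPos d` implies the negative-triple alternative (there are no negative triples). [this work] -/
theorem roundingAlternativeNeg_of_patternPos (h : PatternPos d) : RoundingAlternativeNeg d :=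
  fun A B C hA hB hC hneg _ => absurd (h A B C hA hB hC) (not_le.2 hneg)

/-- **Descent from a negative triple.**  Under `RoundingAlternativeNeg d` and `ResolvedPos d` no up-set triple is negative. [this work] -/
theorem patternPos_of_roundingAlternativeNeg (hRA : RoundingAlternativeNeg d) (hRP : ResolvedPos d) : PatternPos d := by
  suffices key : ∀ n : ℕ, ∀ A B C : Finset (Pd d), IsUpperSet (A : Set (Pd d)) → IsUpperSet (B : Set (Pd d)) →
      IsUpperSet (C : Set (Pd d)) → (univ.filter fun a => ¬ Resolved a A B C).card ≤ n → 0 ≤ sStarD A B C by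
    intro A B C hA hB hC
    exact key _ A B C hA hB hC le_rfl
  intro n
  induction n with
  | zero =>
    intro A B C hA hB hC hn
    refine hRP A B C hA hB hC fun a => ?_
    by_contra hna
    have hmem : a ∈ univ.filter fun a => ¬ Resolved a A B C := by simp [hna]
    have : 0 < (univ.filter fun a => ¬ Resolved a A B C).card := card_pos.2 ⟨a, hmem⟩
    omega
  | succ n ih =>
    intro A B C hA hB hC hn
    by_contra hneg
    rw [not_le] at hneg
    by_cases hall : ∀ a, Resolved a A B C
    · exact absurd (hRP A B C hA hB hC hall) (not_le.2 hneg)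
    · obtain ⟨a, j, sA, sB, sC, hna, hle⟩ := hRA A B C hA hB hC hneg (not_forall.1 hall)
      have hsub : (univ.filter fun b => ¬ Resolved b (rnd sA a j A) (rnd sB a j B) (rnd sC a j C)) ⊆
          (univ.filter fun b => ¬ Resolved b A B C).erase a := by
        intro b hb
        simp only [mem_filter, mem_univ, true_and, mem_erase] at hb ⊢
        refine ⟨?_, ?_⟩
        · rintro rfl; exact hb (resolved_rnd b j sA sB sC hA hB hC)
        · intro hres
          by_cases hba : b = a
          · subst hba; exact hb (resolved_rnd b j sA sB sC hA hB hC)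
          · exact hb (resolved_rnd_of_ne hba j sA sB sC hres)
      have hmem : a ∈ univ.filter fun b => ¬ Resolved b A B C := by simp [hna]
      have hcard : (univ.filter fun b => ¬ Resolved b (rnd sA a j A) (rnd sB a j B) (rnd sC a j C)).card ≤ n := by
        have h1 := card_le_card hsub
        rw [card_erase_of_mem hmem] at h1
        omega
      have h0 := ih _ _ _ (isUpperSet_rnd sA a j hA) (isUpperSet_rnd sB a j hB) (isUpperSet_rnd sC a j hC) hcard
      exact absurd (h0.trans hle) (not_le.2 hneg)

/-- **THE REDUCTION IS LOSSLESS**: `PatternPos d ⟺ ResolvedPos d ∧ RoundingAlternativeNeg d`. [this work] -/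
theorem patternPos_iff_resolvedPos_and_roundingAlternativeNeg :
    PatternPos d ↔ ResolvedPos d ∧ RoundingAlternativeNeg d :=
  ⟨fun h => ⟨resolvedPos_of_patternPos h, roundingAlternativeNeg_of_patternPos h⟩,
    fun h => patternPos_of_roundingAlternativeNeg h.2 h.1⟩

/-- **The pattern inequality on `[3]^d` (⟺ Lieb–Sahi's `C₃` on `[0,1]^d`) is EQUIVALENT to: twisted three-partition positivity on `d` letters AND the
negative-triple rounding alternative.** [this work] -/
theorem patternPos_iff_twistedTPP_and_roundingAlternativeNeg :
    PatternPos d ↔ (∀ (τ : Set (Fin d)) (𝒰 𝒱 𝒲 : Set (Set (Fin d))), IsUpperSet 𝒰 → IsUpperSet 𝒱 → IsUpperSet 𝒲 →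
      0 ≤ threePartNT τ 𝒰 𝒱 𝒲) ∧ RoundingAlternativeNeg d := by
  rw [patternPos_iff_resolvedPos_and_roundingAlternativeNeg, resolvedPos_iff_twistedTPP]

end Summit.CriticalPhenomena.PercolationContinuityZ3.Theorems.SahiGridPattern
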